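import Mathlib
import Summits.KontsevichZagierPeriods.Zeta5Search.Families.CubicalChartCoeffZ
import HarnessLib

/-!
# ζ(5) search — Families: the cubical chart with SIX gaps (`N = 5`) — dictionary of all 21 gap intervals

HONEST FRAMING: systematic search; no irrationality claim unless certified.  Cell `pub-zeta5`, certifier 2 (cert-2 g11,
2026-08-22).  Identities between polynomials / power series with integer coefficients; nothing about `ζ(5)`; no number of
record moves; no conjecture node is used.

The bookkeeping companion of `Families/CubicalChartGeneral` / `Families/CubicalChartCoeffZ` for the thirteen `N = 8` census
classes of `Brown8/LeadingCoefficientsA,B` (seven finite points, six gaps `g₀,…,g₅`, five chart variables; the frame chart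
`z_{η₁} = 0, z_{η_{k+1}} = x_k⋯x₅, z_{η₇} = 1, z_{η₈} = ∞` of fam-brown8's census is `CubicalChartN.chart` with `N = 5`):
* `gChart_eq5` — the six gaps `g₀ = x₁⋯x₅`, `g_w = x_{w+1}⋯x₅(1 − x_w)`;
* **`chart_spanIJ`** (`0 ≤ I ≤ J ≤ 5`, 21 lemmas) — the chart image of the gap interval `g_I + ⋯ + g_J = p_{J+1} − p_I`:
  the monomial `x_{J+1}⋯x₅` for `I = 0`, and `x_{J+1}⋯x₅ · (1 − x_I⋯x_J)` for `I ≥ 1` (1-based `x`; Lean variables 0-based);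
* `sumX_spanIJ` — the span polynomial `Σ_{I ≤ w ≤ J} X_w` of `Families/SpanProductHall` written out;
* `seg lo hi` — the exponent vector of `x_lo ⋯ x_hi` (0-based) with the fifteen product forms `monomial_segIJ`;
* `Mexp_apply6` (the census file's `Brown8.sumTo` as a `Finset.range` sum is `CubicalChart.sumTo_eq_sum` of `Families/CubicalChartLeadPi8v`).
Used by the per-class files `Families/CubicalChartLeadPi9` etc.  Standard axioms only.
-/

noncomputable section

open MvPowerSeries Finset

namespace Summit.KontsevichZagierPeriods.Zeta5Search.Families.Cellular

namespace CubicalChartN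

/-! ## The six gaps -/

/-- The unit factors at numerals. -/
theorem unitFac_num5 : unitFac (1 : Fin 6) = 1 - x 0 ∧ unitFac (2 : Fin 6) = 1 - x 1 ∧ unitFac (3 : Fin 6) = 1 - x 2 ∧
    unitFac (4 : Fin 6) = 1 - x 3 ∧ unitFac (5 : Fin 6) = 1 - x 4 := ⟨rfl, rfl, rfl, rfl, rfl⟩

/-- The six gaps in the chart, as explicit products: `g₀ = x₁⋯x₅`, `g_w = x_{w+1}⋯x₅ (1 − x_w)`. -/
theorem gChart_eq5 : gChart (0 : Fin 6) = x 0 * x 1 * x 2 * x 3 * x 4 ∧ gChart (1 : Fin 6) = x 1 * x 2 * x 3 * x 4 * (1 - x 0) ∧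
    gChart (2 : Fin 6) = x 2 * x 3 * x 4 * (1 - x 1) ∧ gChart (3 : Fin 6) = x 3 * x 4 * (1 - x 2) ∧
    gChart (4 : Fin 6) = x 4 * (1 - x 3) ∧ gChart (5 : Fin 6) = 1 - x 4 := by
  obtain ⟨u1, u2, u3, u4, u5⟩ := unitFac_num5
  simp only [gChart, tail, monomial_symm_eq, Fin.prod_univ_five, unitFac_zero, u1, u2, u3, u4, u5]
  simp

/-! ## The chart images of the 21 gap intervals `[I, J]` -/

/-- Chart image of the gap interval `[0, 0]`: `g₀ ↦ x₁⋯x₅` (1-based points/variables; Lean variables 0-based). -/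
theorem chart_span00 : chart (MvPolynomial.X 0 : MvPolynomial (Fin 6) ℤ) = x 0 * x 1 * x 2 * x 3 * x 4 := by
  obtain ⟨g0, g1, g2, g3, g4, g5⟩ := gChart_eq5
  simp only [chart_X, g0]

/-- Chart image of the gap interval `[0, 1]`: `g₀+⋯+g_1` ↦ `x_2⋯x₅` (1-based points/variables; Lean variables 0-based). -/
theorem chart_span01 : chart (MvPolynomial.X 0 + MvPolynomial.X 1 : MvPolynomial (Fin 6) ℤ) = x 1 * x 2 * x 3 * x 4 := by
  obtain ⟨g0, g1, g2, g3, g4, g5⟩ := gChart_eq5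
  simp only [map_add, chart_X, g0, g1]
  ring

/-- Chart image of the gap interval `[0, 2]`: `g₀+⋯+g_2` ↦ `x_3⋯x₅` (1-based points/variables; Lean variables 0-based). -/
theorem chart_span02 : chart (MvPolynomial.X 0 + MvPolynomial.X 1 + MvPolynomial.X 2 : MvPolynomial (Fin 6) ℤ) = x 2 * x 3 * x 4 := by
  obtain ⟨g0, g1, g2, g3, g4, g5⟩ := gChart_eq5
  simp only [map_add, chart_X, g0, g1, g2]
  ring

/-- Chart image of the gap interval `[0, 3]`: `g₀+⋯+g_3` ↦ `x_4⋯x₅` (1-based points/variables; Lean variables 0-based). -/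
theorem chart_span03 : chart (MvPolynomial.X 0 + MvPolynomial.X 1 + MvPolynomial.X 2 + MvPolynomial.X 3 : MvPolynomial (Fin 6) ℤ) = x 3 * x 4 := by
  obtain ⟨g0, g1, g2, g3, g4, g5⟩ := gChart_eq5
  simp only [map_add, chart_X, g0, g1, g2, g3]
  ring

/-- Chart image of the gap interval `[0, 4]`: `g₀+⋯+g_4` ↦ `x_5⋯x₅` (1-based points/variables; Lean variables 0-based). -/
theorem chart_span04 : chart (MvPolynomial.X 0 + MvPolynomial.X 1 + MvPolynomial.X 2 + MvPolynomial.X 3 + MvPolynomial.X 4 : MvPolynomial (Fin 6) ℤ) = x 4 := by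
  obtain ⟨g0, g1, g2, g3, g4, g5⟩ := gChart_eq5
  simp only [map_add, chart_X, g0, g1, g2, g3, g4]
  ring

/-- Chart image of the gap interval `[0, 5]`: `g₀+⋯+g_5` ↦ `1` (1-based points/variables; Lean variables 0-based). -/
theorem chart_span05 : chart (MvPolynomial.X 0 + MvPolynomial.X 1 + MvPolynomial.X 2 + MvPolynomial.X 3 + MvPolynomial.X 4 + MvPolynomial.X 5 : MvPolynomial (Fin 6) ℤ) = 1 := by
  obtain ⟨g0, g1, g2, g3, g4, g5⟩ := gChart_eq5
  simp only [map_add, chart_X, g0, g1, g2, g3, g4, g5]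
  ring

/-- Chart image of the gap interval `[1, 1]`: `g_1+⋯+g_1` ↦ `p_2 − p_1` (1-based points/variables; Lean variables 0-based). -/
theorem chart_span11 : chart (MvPolynomial.X 1 : MvPolynomial (Fin 6) ℤ) = x 1 * x 2 * x 3 * x 4 * (1 - x 0) := by
  obtain ⟨g0, g1, g2, g3, g4, g5⟩ := gChart_eq5
  simp only [chart_X, g1]

/-- Chart image of the gap interval `[1, 2]`: `g_1+⋯+g_2` ↦ `p_3 − p_1` (1-based points/variables; Lean variables 0-based). -/
theorem chart_span12 : chart (MvPolynomial.X 1 + MvPolynomial.X 2 : MvPolynomial (Fin 6) ℤ) = x 2 * x 3 * x 4 * (1 - x 0 * x 1) := by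
  obtain ⟨g0, g1, g2, g3, g4, g5⟩ := gChart_eq5
  simp only [map_add, chart_X, g1, g2]
  ring

/-- Chart image of the gap interval `[1, 3]`: `g_1+⋯+g_3` ↦ `p_4 − p_1` (1-based points/variables; Lean variables 0-based). -/
theorem chart_span13 : chart (MvPolynomial.X 1 + MvPolynomial.X 2 + MvPolynomial.X 3 : MvPolynomial (Fin 6) ℤ) = x 3 * x 4 * (1 - x 0 * x 1 * x 2) := by
  obtain ⟨g0, g1, g2, g3, g4, g5⟩ := gChart_eq5
  simp only [map_add, chart_X, g1, g2, g3]
  ring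

/-- Chart image of the gap interval `[1, 4]`: `g_1+⋯+g_4` ↦ `p_5 − p_1` (1-based points/variables; Lean variables 0-based). -/
theorem chart_span14 : chart (MvPolynomial.X 1 + MvPolynomial.X 2 + MvPolynomial.X 3 + MvPolynomial.X 4 : MvPolynomial (Fin 6) ℤ) = x 4 * (1 - x 0 * x 1 * x 2 * x 3) := by
  obtain ⟨g0, g1, g2, g3, g4, g5⟩ := gChart_eq5
  simp only [map_add, chart_X, g1, g2, g3, g4]
  ring

/-- Chart image of the gap interval `[1, 5]`: `g_1+⋯+g_5` ↦ `p_6 − p_1` (1-based points/variables; Lean variables 0-based). -/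
theorem chart_span15 : chart (MvPolynomial.X 1 + MvPolynomial.X 2 + MvPolynomial.X 3 + MvPolynomial.X 4 + MvPolynomial.X 5 : MvPolynomial (Fin 6) ℤ) = (1 - x 0 * x 1 * x 2 * x 3 * x 4) := by
  obtain ⟨g0, g1, g2, g3, g4, g5⟩ := gChart_eq5
  simp only [map_add, chart_X, g1, g2, g3, g4, g5]
  ring

/-- Chart image of the gap interval `[2, 2]`: `g_2+⋯+g_2` ↦ `p_3 − p_2` (1-based points/variables; Lean variables 0-based). -/
theorem chart_span22 : chart (MvPolynomial.X 2 : MvPolynomial (Fin 6) ℤ) = x 2 * x 3 * x 4 * (1 - x 1) := by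
  obtain ⟨g0, g1, g2, g3, g4, g5⟩ := gChart_eq5
  simp only [chart_X, g2]

/-- Chart image of the gap interval `[2, 3]`: `g_2+⋯+g_3` ↦ `p_4 − p_2` (1-based points/variables; Lean variables 0-based). -/
theorem chart_span23 : chart (MvPolynomial.X 2 + MvPolynomial.X 3 : MvPolynomial (Fin 6) ℤ) = x 3 * x 4 * (1 - x 1 * x 2) := by
  obtain ⟨g0, g1, g2, g3, g4, g5⟩ := gChart_eq5
  simp only [map_add, chart_X, g2, g3]
  ring

/-- Chart image of the gap interval `[2, 4]`: `g_2+⋯+g_4` ↦ `p_5 − p_2` (1-based points/variables; Lean variables 0-based). -/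
theorem chart_span24 : chart (MvPolynomial.X 2 + MvPolynomial.X 3 + MvPolynomial.X 4 : MvPolynomial (Fin 6) ℤ) = x 4 * (1 - x 1 * x 2 * x 3) := by
  obtain ⟨g0, g1, g2, g3, g4, g5⟩ := gChart_eq5
  simp only [map_add, chart_X, g2, g3, g4]
  ring

/-- Chart image of the gap interval `[2, 5]`: `g_2+⋯+g_5` ↦ `p_6 − p_2` (1-based points/variables; Lean variables 0-based). -/
theorem chart_span25 : chart (MvPolynomial.X 2 + MvPolynomial.X 3 + MvPolynomial.X 4 + MvPolynomial.X 5 : MvPolynomial (Fin 6) ℤ) = (1 - x 1 * x 2 * x 3 * x 4) := by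
  obtain ⟨g0, g1, g2, g3, g4, g5⟩ := gChart_eq5
  simp only [map_add, chart_X, g2, g3, g4, g5]
  ring

/-- Chart image of the gap interval `[3, 3]`: `g_3+⋯+g_3` ↦ `p_4 − p_3` (1-based points/variables; Lean variables 0-based). -/
theorem chart_span33 : chart (MvPolynomial.X 3 : MvPolynomial (Fin 6) ℤ) = x 3 * x 4 * (1 - x 2) := by
  obtain ⟨g0, g1, g2, g3, g4, g5⟩ := gChart_eq5
  simp only [chart_X, g3]

/-- Chart image of the gap interval `[3, 4]`: `g_3+⋯+g_4` ↦ `p_5 − p_3` (1-based points/variables; Lean variables 0-based). -/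
theorem chart_span34 : chart (MvPolynomial.X 3 + MvPolynomial.X 4 : MvPolynomial (Fin 6) ℤ) = x 4 * (1 - x 2 * x 3) := by
  obtain ⟨g0, g1, g2, g3, g4, g5⟩ := gChart_eq5
  simp only [map_add, chart_X, g3, g4]
  ring

/-- Chart image of the gap interval `[3, 5]`: `g_3+⋯+g_5` ↦ `p_6 − p_3` (1-based points/variables; Lean variables 0-based). -/
theorem chart_span35 : chart (MvPolynomial.X 3 + MvPolynomial.X 4 + MvPolynomial.X 5 : MvPolynomial (Fin 6) ℤ) = (1 - x 2 * x 3 * x 4) := by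
  obtain ⟨g0, g1, g2, g3, g4, g5⟩ := gChart_eq5
  simp only [map_add, chart_X, g3, g4, g5]
  ring

/-- Chart image of the gap interval `[4, 4]`: `g_4+⋯+g_4` ↦ `p_5 − p_4` (1-based points/variables; Lean variables 0-based). -/
theorem chart_span44 : chart (MvPolynomial.X 4 : MvPolynomial (Fin 6) ℤ) = x 4 * (1 - x 3) := by
  obtain ⟨g0, g1, g2, g3, g4, g5⟩ := gChart_eq5
  simp only [chart_X, g4]

/-- Chart image of the gap interval `[4, 5]`: `g_4+⋯+g_5` ↦ `p_6 − p_4` (1-based points/variables; Lean variables 0-based). -/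
theorem chart_span45 : chart (MvPolynomial.X 4 + MvPolynomial.X 5 : MvPolynomial (Fin 6) ℤ) = (1 - x 3 * x 4) := by
  obtain ⟨g0, g1, g2, g3, g4, g5⟩ := gChart_eq5
  simp only [map_add, chart_X, g4, g5]
  ring

/-- Chart image of the gap interval `[5, 5]`: `g_5+⋯+g_5` ↦ `p_6 − p_5` (1-based points/variables; Lean variables 0-based). -/
theorem chart_span55 : chart (MvPolynomial.X 5 : MvPolynomial (Fin 6) ℤ) = (1 - x 4) := by
  obtain ⟨g0, g1, g2, g3, g4, g5⟩ := gChart_eq5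
  simp only [chart_X, g5]

/-! ## The gap-interval sums `X_I + ⋯ + X_J` as filtered sums over `Fin 6` -/

/-- `Σ_{w : 0 ≤ w ≤ 0} X_w = X₀` (the span polynomial of the gap interval `[0, 0]`). -/
theorem sumX_span00 : ∑ w ∈ (univ.filter fun w : Fin 6 => 0 ≤ w.val ∧ w.val < 1), (MvPolynomial.X w : MvPolynomial (Fin 6) ℤ) =
    MvPolynomial.X 0 := by
  simp [Finset.sum_filter]

/-- `Σ_{w : 0 ≤ w ≤ 1} X_w = X₀ + X₁` (the span polynomial of the gap interval `[0, 1]`). -/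
theorem sumX_span01 : ∑ w ∈ (univ.filter fun w : Fin 6 => 0 ≤ w.val ∧ w.val < 2), (MvPolynomial.X w : MvPolynomial (Fin 6) ℤ) =
    MvPolynomial.X 0 + MvPolynomial.X 1 := by
  simp [Finset.sum_filter, Fin.sum_univ_six]

/-- `Σ_{w : 0 ≤ w ≤ 2} X_w = X₀ + X₁ + X₂` (the span polynomial of the gap interval `[0, 2]`). -/
theorem sumX_span02 : ∑ w ∈ (univ.filter fun w : Fin 6 => 0 ≤ w.val ∧ w.val < 3), (MvPolynomial.X w : MvPolynomial (Fin 6) ℤ) =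
    MvPolynomial.X 0 + MvPolynomial.X 1 + MvPolynomial.X 2 := by
  simp [Finset.sum_filter, Fin.sum_univ_six]

/-- `Σ_{w : 0 ≤ w ≤ 3} X_w = X₀ + X₁ + X₂ + X₃` (the span polynomial of the gap interval `[0, 3]`). -/
theorem sumX_span03 : ∑ w ∈ (univ.filter fun w : Fin 6 => 0 ≤ w.val ∧ w.val < 4), (MvPolynomial.X w : MvPolynomial (Fin 6) ℤ) =
    MvPolynomial.X 0 + MvPolynomial.X 1 + MvPolynomial.X 2 + MvPolynomial.X 3 := by
  simp [Finset.sum_filter, Fin.sum_univ_six]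

/-- `Σ_{w : 0 ≤ w ≤ 4} X_w = X₀ + X₁ + X₂ + X₃ + X₄` (the span polynomial of the gap interval `[0, 4]`). -/
theorem sumX_span04 : ∑ w ∈ (univ.filter fun w : Fin 6 => 0 ≤ w.val ∧ w.val < 5), (MvPolynomial.X w : MvPolynomial (Fin 6) ℤ) =
    MvPolynomial.X 0 + MvPolynomial.X 1 + MvPolynomial.X 2 + MvPolynomial.X 3 + MvPolynomial.X 4 := by
  simp [Finset.sum_filter, Fin.sum_univ_six]

/-- `Σ_{w : 0 ≤ w ≤ 5} X_w = X₀ + X₁ + X₂ + X₃ + X₄ + X₅` (the span polynomial of the gap interval `[0, 5]`). -/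
theorem sumX_span05 : ∑ w ∈ (univ.filter fun w : Fin 6 => 0 ≤ w.val ∧ w.val < 6), (MvPolynomial.X w : MvPolynomial (Fin 6) ℤ) =
    MvPolynomial.X 0 + MvPolynomial.X 1 + MvPolynomial.X 2 + MvPolynomial.X 3 + MvPolynomial.X 4 + MvPolynomial.X 5 := by
  simp [Fin.sum_univ_six]

/-- `Σ_{w : 1 ≤ w ≤ 1} X_w = X₁` (the span polynomial of the gap interval `[1, 1]`). -/
theorem sumX_span11 : ∑ w ∈ (univ.filter fun w : Fin 6 => 1 ≤ w.val ∧ w.val < 2), (MvPolynomial.X w : MvPolynomial (Fin 6) ℤ) =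
    MvPolynomial.X 1 := by
  simp [Finset.sum_filter, Fin.sum_univ_six]

/-- `Σ_{w : 1 ≤ w ≤ 2} X_w = X₁ + X₂` (the span polynomial of the gap interval `[1, 2]`). -/
theorem sumX_span12 : ∑ w ∈ (univ.filter fun w : Fin 6 => 1 ≤ w.val ∧ w.val < 3), (MvPolynomial.X w : MvPolynomial (Fin 6) ℤ) =
    MvPolynomial.X 1 + MvPolynomial.X 2 := by
  simp [Finset.sum_filter, Fin.sum_univ_six]

/-- `Σ_{w : 1 ≤ w ≤ 3} X_w = X₁ + X₂ + X₃` (the span polynomial of the gap interval `[1, 3]`). -/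
theorem sumX_span13 : ∑ w ∈ (univ.filter fun w : Fin 6 => 1 ≤ w.val ∧ w.val < 4), (MvPolynomial.X w : MvPolynomial (Fin 6) ℤ) =
    MvPolynomial.X 1 + MvPolynomial.X 2 + MvPolynomial.X 3 := by
  simp [Finset.sum_filter, Fin.sum_univ_six]

/-- `Σ_{w : 1 ≤ w ≤ 4} X_w = X₁ + X₂ + X₃ + X₄` (the span polynomial of the gap interval `[1, 4]`). -/
theorem sumX_span14 : ∑ w ∈ (univ.filter fun w : Fin 6 => 1 ≤ w.val ∧ w.val < 5), (MvPolynomial.X w : MvPolynomial (Fin 6) ℤ) =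
    MvPolynomial.X 1 + MvPolynomial.X 2 + MvPolynomial.X 3 + MvPolynomial.X 4 := by
  simp [Finset.sum_filter, Fin.sum_univ_six]

/-- `Σ_{w : 1 ≤ w ≤ 5} X_w = X₁ + X₂ + X₃ + X₄ + X₅` (the span polynomial of the gap interval `[1, 5]`). -/
theorem sumX_span15 : ∑ w ∈ (univ.filter fun w : Fin 6 => 1 ≤ w.val ∧ w.val < 6), (MvPolynomial.X w : MvPolynomial (Fin 6) ℤ) =
    MvPolynomial.X 1 + MvPolynomial.X 2 + MvPolynomial.X 3 + MvPolynomial.X 4 + MvPolynomial.X 5 := by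
  simp [Finset.sum_filter, Fin.sum_univ_six]

/-- `Σ_{w : 2 ≤ w ≤ 2} X_w = X₂` (the span polynomial of the gap interval `[2, 2]`). -/
theorem sumX_span22 : ∑ w ∈ (univ.filter fun w : Fin 6 => 2 ≤ w.val ∧ w.val < 3), (MvPolynomial.X w : MvPolynomial (Fin 6) ℤ) =
    MvPolynomial.X 2 := by
  simp [Finset.sum_filter, Fin.sum_univ_six]

/-- `Σ_{w : 2 ≤ w ≤ 3} X_w = X₂ + X₃` (the span polynomial of the gap interval `[2, 3]`). -/
theorem sumX_span23 : ∑ w ∈ (univ.filter fun w : Fin 6 => 2 ≤ w.val ∧ w.val < 4), (MvPolynomial.X w : MvPolynomial (Fin 6) ℤ) =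
    MvPolynomial.X 2 + MvPolynomial.X 3 := by
  simp [Finset.sum_filter, Fin.sum_univ_six]

/-- `Σ_{w : 2 ≤ w ≤ 4} X_w = X₂ + X₃ + X₄` (the span polynomial of the gap interval `[2, 4]`). -/
theorem sumX_span24 : ∑ w ∈ (univ.filter fun w : Fin 6 => 2 ≤ w.val ∧ w.val < 5), (MvPolynomial.X w : MvPolynomial (Fin 6) ℤ) =
    MvPolynomial.X 2 + MvPolynomial.X 3 + MvPolynomial.X 4 := by
  simp [Finset.sum_filter, Fin.sum_univ_six]

/-- `Σ_{w : 2 ≤ w ≤ 5} X_w = X₂ + X₃ + X₄ + X₅` (the span polynomial of the gap interval `[2, 5]`). -/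
theorem sumX_span25 : ∑ w ∈ (univ.filter fun w : Fin 6 => 2 ≤ w.val ∧ w.val < 6), (MvPolynomial.X w : MvPolynomial (Fin 6) ℤ) =
    MvPolynomial.X 2 + MvPolynomial.X 3 + MvPolynomial.X 4 + MvPolynomial.X 5 := by
  simp [Finset.sum_filter, Fin.sum_univ_six]

/-- `Σ_{w : 3 ≤ w ≤ 3} X_w = X₃` (the span polynomial of the gap interval `[3, 3]`). -/
theorem sumX_span33 : ∑ w ∈ (univ.filter fun w : Fin 6 => 3 ≤ w.val ∧ w.val < 4), (MvPolynomial.X w : MvPolynomial (Fin 6) ℤ) =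
    MvPolynomial.X 3 := by
  simp [Finset.sum_filter, Fin.sum_univ_six]

/-- `Σ_{w : 3 ≤ w ≤ 4} X_w = X₃ + X₄` (the span polynomial of the gap interval `[3, 4]`). -/
theorem sumX_span34 : ∑ w ∈ (univ.filter fun w : Fin 6 => 3 ≤ w.val ∧ w.val < 5), (MvPolynomial.X w : MvPolynomial (Fin 6) ℤ) =
    MvPolynomial.X 3 + MvPolynomial.X 4 := by
  simp [Finset.sum_filter, Fin.sum_univ_six]

/-- `Σ_{w : 3 ≤ w ≤ 5} X_w = X₃ + X₄ + X₅` (the span polynomial of the gap interval `[3, 5]`). -/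
theorem sumX_span35 : ∑ w ∈ (univ.filter fun w : Fin 6 => 3 ≤ w.val ∧ w.val < 6), (MvPolynomial.X w : MvPolynomial (Fin 6) ℤ) =
    MvPolynomial.X 3 + MvPolynomial.X 4 + MvPolynomial.X 5 := by
  simp [Finset.sum_filter, Fin.sum_univ_six]

/-- `Σ_{w : 4 ≤ w ≤ 4} X_w = X₄` (the span polynomial of the gap interval `[4, 4]`). -/
theorem sumX_span44 : ∑ w ∈ (univ.filter fun w : Fin 6 => 4 ≤ w.val ∧ w.val < 5), (MvPolynomial.X w : MvPolynomial (Fin 6) ℤ) =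
    MvPolynomial.X 4 := by
  simp [Finset.sum_filter, Fin.sum_univ_six]

/-- `Σ_{w : 4 ≤ w ≤ 5} X_w = X₄ + X₅` (the span polynomial of the gap interval `[4, 5]`). -/
theorem sumX_span45 : ∑ w ∈ (univ.filter fun w : Fin 6 => 4 ≤ w.val ∧ w.val < 6), (MvPolynomial.X w : MvPolynomial (Fin 6) ℤ) =
    MvPolynomial.X 4 + MvPolynomial.X 5 := by
  simp [Finset.sum_filter, Fin.sum_univ_six]

/-- `Σ_{w : 5 ≤ w ≤ 5} X_w = X₅` (the span polynomial of the gap interval `[5, 5]`). -/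
theorem sumX_span55 : ∑ w ∈ (univ.filter fun w : Fin 6 => 5 ≤ w.val ∧ w.val < 6), (MvPolynomial.X w : MvPolynomial (Fin 6) ℤ) =
    MvPolynomial.X 5 := by
  simp [Finset.sum_filter, Fin.sum_univ_six]

/-! ## Segment monomials `x_lo ⋯ x_hi` -/

/-- Exponent vector of the monomial `x_lo x_{lo+1} ⋯ x_hi` (0-based variables). -/
def seg (lo hi : ℕ) : Fin 5 →₀ ℕ := Finsupp.equivFunOnFinite.symm fun k => if lo ≤ k.val ∧ k.val ≤ hi then 1 else 0

/-- The entries of `seg`. -/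
@[simp] theorem seg_apply (lo hi : ℕ) (k : Fin 5) : seg lo hi k = if lo ≤ k.val ∧ k.val ≤ hi then 1 else 0 := by
  simp [seg]

/-- `x^(seg 0 0) = x 0`. -/
theorem monomial_seg00 : (monomial (seg 0 0) (1 : ℤ) : T 5) = x 0 := by
  simp only [seg, monomial_symm_eq, Fin.prod_univ_five]
  simp

/-- `x^(seg 0 1) = x 0 * x 1`. -/
theorem monomial_seg01 : (monomial (seg 0 1) (1 : ℤ) : T 5) = x 0 * x 1 := by
  simp only [seg, monomial_symm_eq, Fin.prod_univ_five]
  simp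

/-- `x^(seg 0 2) = x 0 * x 1 * x 2`. -/
theorem monomial_seg02 : (monomial (seg 0 2) (1 : ℤ) : T 5) = x 0 * x 1 * x 2 := by
  simp only [seg, monomial_symm_eq, Fin.prod_univ_five]
  simp

/-- `x^(seg 0 3) = x 0 * x 1 * x 2 * x 3`. -/
theorem monomial_seg03 : (monomial (seg 0 3) (1 : ℤ) : T 5) = x 0 * x 1 * x 2 * x 3 := by
  simp only [seg, monomial_symm_eq, Fin.prod_univ_five]
  simp

/-- `x^(seg 0 4) = x 0 * x 1 * x 2 * x 3 * x 4`. -/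
theorem monomial_seg04 : (monomial (seg 0 4) (1 : ℤ) : T 5) = x 0 * x 1 * x 2 * x 3 * x 4 := by
  simp only [seg, monomial_symm_eq, Fin.prod_univ_five]
  simp

/-- `x^(seg 1 1) = x 1`. -/
theorem monomial_seg11 : (monomial (seg 1 1) (1 : ℤ) : T 5) = x 1 := by
  simp only [seg, monomial_symm_eq, Fin.prod_univ_five]
  simp

/-- `x^(seg 1 2) = x 1 * x 2`. -/
theorem monomial_seg12 : (monomial (seg 1 2) (1 : ℤ) : T 5) = x 1 * x 2 := by
  simp only [seg, monomial_symm_eq, Fin.prod_univ_five]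
  simp

/-- `x^(seg 1 3) = x 1 * x 2 * x 3`. -/
theorem monomial_seg13 : (monomial (seg 1 3) (1 : ℤ) : T 5) = x 1 * x 2 * x 3 := by
  simp only [seg, monomial_symm_eq, Fin.prod_univ_five]
  simp

/-- `x^(seg 1 4) = x 1 * x 2 * x 3 * x 4`. -/
theorem monomial_seg14 : (monomial (seg 1 4) (1 : ℤ) : T 5) = x 1 * x 2 * x 3 * x 4 := by
  simp only [seg, monomial_symm_eq, Fin.prod_univ_five]
  simp

/-- `x^(seg 2 2) = x 2`. -/
theorem monomial_seg22 : (monomial (seg 2 2) (1 : ℤ) : T 5) = x 2 := by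
  simp only [seg, monomial_symm_eq, Fin.prod_univ_five]
  simp

/-- `x^(seg 2 3) = x 2 * x 3`. -/
theorem monomial_seg23 : (monomial (seg 2 3) (1 : ℤ) : T 5) = x 2 * x 3 := by
  simp only [seg, monomial_symm_eq, Fin.prod_univ_five]
  simp

/-- `x^(seg 2 4) = x 2 * x 3 * x 4`. -/
theorem monomial_seg24 : (monomial (seg 2 4) (1 : ℤ) : T 5) = x 2 * x 3 * x 4 := by
  simp only [seg, monomial_symm_eq, Fin.prod_univ_five]
  simp

/-- `x^(seg 3 3) = x 3`. -/
theorem monomial_seg33 : (monomial (seg 3 3) (1 : ℤ) : T 5) = x 3 := by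
  simp only [seg, monomial_symm_eq, Fin.prod_univ_five]
  simp

/-- `x^(seg 3 4) = x 3 * x 4`. -/
theorem monomial_seg34 : (monomial (seg 3 4) (1 : ℤ) : T 5) = x 3 * x 4 := by
  simp only [seg, monomial_symm_eq, Fin.prod_univ_five]
  simp

/-- `x^(seg 4 4) = x 4`. -/
theorem monomial_seg44 : (monomial (seg 4 4) (1 : ℤ) : T 5) = x 4 := by
  simp only [seg, monomial_symm_eq, Fin.prod_univ_five]
  simp

/-! ## Census-file vocabulary -/

/-- `M(β)` for six gaps, with the sum over `Fin 6` (so that `Fin.sum_univ_six` evaluates it). -/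
theorem Mexp_apply6 (β : Fin 6 →₀ ℕ) (k : Fin 5) :
    Mexp β k = ∑ w : Fin 6, if w.val ≤ k.val then β w else 0 := Mexp_apply β k

end CubicalChartN

end Summit.KontsevichZagierPeriods.Zeta5Search.Families.Cellular
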